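import Summits.BirchSwinnertonDyer.Rank1Residual.Partition.Rows
import Literature.NumberTheory.EllipticCurves.GreenbergSelmer
import Literature.NumberTheory.EllipticCurves.PAdicLFunction
import Literature.NumberTheory.EllipticCurves.Wuthrich2014.IntegralPAdicLFunctionMultiplicative
import HarnessLib

/-!
# Route `PrintX11a` (cell `bsd-print-x11a`, seat p3), crux 3 `X11aNonSurjEulerHalf` (item stmt-BirchSwinnertonDyer-20406):
# the objects a GLUED SPLIT posits — Greenberg's `μ = 0` at the NON-surjective X11a pairs, literal (Mu) and
# analytic (MuAn), each for all `p` and for `p = 3` alone — as Theses-free `Prop` constants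
# (`--supports stmt-BirchSwinnertonDyer-20406`)

This module imports NO Theses file (pattern of `ErratumRoadFiveNonSurjCornerBranchesDefs.lean`, bsd-stepL corner-p1 g6),
so the route file `Theses/PrintX11a.lean` MAY import it and a planner's `route edit --split X11aNonSurjEulerHalf --into …`
can type the children BY NAME as the constants below; the glue (children ∧ named facts ⟹ the crux BY NAME) lives in
the sibling `Theorems/PrintX11aNonSurjEulerHalfOfBranches.lean`, which imports the route file; the fact-binder versions
are already landed (`Theorems/PrintX11aNonSurjEulerHalfOfMu.lean`, p539522: `x11aNonSurjEulerHalf_of_katoFacts_of_muZero`,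
`…_of_katoFacts_of_muAn`, `…_five_of_nonSurjCornerTwinMu[An]`, `…_of_nonSurjCornerTwinMu_of_muZeroAtThree`).

THE CRUX (item 20406): for every globally minimal `W/ℚ` and prime `p` with `(W,p) ∈ X11a` (`r_an = 0`, `p ≠ 2`,
`p ∥ N`, `E[p]` irreducible, no (ram) witness) and `ρ̄_{W,p}` NOT onto (`p ∈ {3,5,7}`, `p ∣ ord_p Δ_min`, images
`3Ns/3Nn/5Ns/5S4/7Ns`): `Typed.MissingUpperBoundAt W p`. p539522 proves it from TWELVE named Literature facts (Kato 2004
§12 ∕ §17.13 at a multiplicative odd prime in the `⊗ℚ` shape — NO image hypothesis —, Greenberg 1999 Thm. 1.5,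
Wuthrich 2014 Cor. 18, Stein–Wuthrich 2013 Thm. 6.1 ×2, Greenberg–Stevens, GZK, modularity ×2) plus EXACTLY ONE open
shape, Greenberg's `μ(X(E/ℚ_∞)) = 0` at those pairs (resp. from thirteen facts plus its ANALYTIC form). The constants:

* **Mu = `X11aNonSurjMu`** — Greenberg's `μ = 0` (LNM 1716 Conj. 1.11) for every cyclotomic Selmer dual datum of every
  non-surjective X11a pair, all `p` (so `p ∈ {3,5,7}`): verbatim the binder `hμ` of `x11aNonSurjEulerHalf_of_katoFacts_of_muZero`.
* **Mu@3 = `X11aNonSurjMuAtThree`** — the same at `p = 3` only (images `3Ns/3Nn`; the N7 residue of the lane): the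
  child that has NO sibling elsewhere in the tree. At `p ∈ {5,7}` the literal sibling is the K2 constant
  `NonSurjCornerTwinMu` (same namespace, `ErratumRoadFiveNonSurjCornerBranchesDefs.lean`) and the analytic one is
  ITEM stmt-BirchSwinnertonDyer-19948 `Theses.ErratumRoadFive.NonSurjCornerTwinMuAn` (shared staffing).
* **MuAn = `X11aNonSurjMuAn`**, **MuAn@3 = `X11aNonSurjMuAnAtThree`** — the ANALYTIC forms: at the same pairs, for
  every newform `f`, period ratio `ϖ` (`ϖ·Ω_E = Ω⁺_f`) and Mazur–Tate–Teitelbaum function `L` with allowable root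
  `a = a_p = ±1`, SOME coefficient of the Néron-normalised `ϖ·L ∈ Λ` (Wuthrich Cor. 18) is a `p`-adic unit — verbatim
  the binder `hAn` of `x11aNonSurjEulerHalf_of_katoFacts_of_muAn`; it implies Mu pairwise by the corner seat's
  KERNEL-CHECKED `μ`-transfer without big image at `p ∥ N` (`X11b.MultMu.mu_eq_zero_of_multFine`, modulo the
  construction fact `Kato2004.exists_multDivisibilityInputs_fine`); PER PAIR a finite exact modular-symbol
  computation (ty3's μ-witness engine; at a NON-split prime a unit `L(E,1)/Ω_E` is already the certificate,
  `x11a_missingUpperBoundAt_of_not_surj_of_nonsplit_of_unit_value`); class-wide = Conj. 1.11 through the main conjecture.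

HONEST FRAMING: four `Prop` constants (restrictions ∕ analytic companions of an OPEN crux; NOTHING asserted); no named
fact minted, no theorem, no `sorry`; the split is NOT claimed lossless (the children are sufficient, not necessary); the
crux 20406 and the leaf `ClassX11a` stay OPEN; BSD is not advanced; no census word moves. «beyond-print theorem: NO».

References: [GreenbergLNM1716] §1 Conj. 1.11 (p. 61), p. 121; [Wuthrich2014] Cor. 18 (p. 398), Prop. 21 (p. 400);
[MazurTateTeitelbaum1986] §I.10, §I.14; [Kato2004Asterisque] Thm. 12.4–12.6, §17.13; tree:
`Theorems/PrintX11aNonSurjEulerHalfOfMu.lean` (p539522), `Theorems/ErratumRoadFiveNonSurjCornerBranchesDefs.lean` (p486726).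
-/

set_option autoImplicit false
set_option linter.dupNamespace false

noncomputable section

open scoped Classical NumberField MatrixGroups ModularForm

open CongruenceSubgroup WeierstrassCurve Field
  Literature.NumberTheory.EllipticCurves
  Literature.NumberTheory.EllipticCurves.ModularForms
  Literature.NumberTheory.EllipticCurves.Rank1Residual
  Summit.BirchSwinnertonDyer.Rank1Residual

namespace Summit.BirchSwinnertonDyer.BirchSwinnertonDyer.Theorems

/-- [crux branch Mu of item 20406 `X11aNonSurjEulerHalf`] **Greenberg's `μ = 0` at the non-surjective X11a pairs
(literal shape, all `p`).** For every globally minimal `W` in class X11a (`r_an = 0`, `p ∥ N` odd, `E[p]` irreducible,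
no (ram) witness) with `ρ̄_{W,p}` NOT onto, every cyclotomic `(κ, γ)` and every Selmer dual datum `D` of
`Sel_{p^∞}(E/ℚ_∞)`: `μ(X) = 0`. Greenberg's Conj. 1.11 at an irreducible NON-surjective image and a multiplicative
prime (LNM 1716 p. 121: «it seems very difficult to verify this even for specific examples»); the one input of Kato's
INTEGRAL divisibility at such an image that print does not supply (Wuthrich 2014 Prop. 21 excludes exactly «primes for
which the Galois representation on `E[p]` is neither surjective nor contained in a Borel subgroup»). A `Prop` constant;
OPEN; nothing asserted. [cite: GreenbergLNM1716, §1 Conj. 1.11 (p. 61) and p. 121 (shape only; nothing asserted)]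
[cite: Wuthrich2014, Prop. 21 (p. 400) (the excluded image)] -/
@[conjecture]
def X11aNonSurjMu : Prop :=
  ∀ (W : WeierstrassCurve ℚ) [W.IsElliptic] [W.IsGloballyMinimal] (p : ℕ) [Fact p.Prime],
    ClassX11a W p → ¬ Surj W p →
    ∀ (κ : ZpExtension ℚ p) (γ : Field.absoluteGaloisGroup ℚ),
      κ.IsCyclotomic → κ.IsTopGenerator γ → IsCyclotomicVariable p γ →
      ∀ D : W.SelmerDualData κ γ, D.mu = 0

/-- [crux branch Mu@3 of item 20406 `X11aNonSurjEulerHalf`] **Greenberg's `μ = 0` at the non-surjective X11a pairs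
with `p = 3`** (images `3Ns/3Nn`; the N7 residue of the lane): the restriction of `X11aNonSurjMu` to `p = 3`, the one
child with no sibling constant in the tree (at `p ∈ {5,7}` see `NonSurjCornerTwinMu` ∕ item 19948). A `Prop` constant;
OPEN; nothing asserted. [cite: GreenbergLNM1716, §1 Conj. 1.11 (p. 61) (shape only; nothing asserted)] -/
@[conjecture]
def X11aNonSurjMuAtThree : Prop :=
  ∀ (W : WeierstrassCurve ℚ) [W.IsElliptic] [W.IsGloballyMinimal] (p : ℕ) [Fact p.Prime],
    ClassX11a W p → ¬ Surj W p → p = 3 →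
    ∀ (κ : ZpExtension ℚ p) (γ : Field.absoluteGaloisGroup ℚ),
      κ.IsCyclotomic → κ.IsTopGenerator γ → IsCyclotomicVariable p γ →
      ∀ D : W.SelmerDualData κ γ, D.mu = 0

/-- [crux branch MuAn of item 20406 `X11aNonSurjEulerHalf` — the ANALYTIC form of Mu] **analytic `μ = 0` at the
non-surjective X11a pairs (all `p`).** For every such pair, every newform `f` of `W`, the period ratio `ϖ`
(`ϖ·Ω_W = Ω⁺_f`) and every Mazur–Tate–Teitelbaum function `L` of `f` at `p` with allowable root `a = a_p`
(`a = 1` at a split, `a = −1` at a non-split multiplicative `p`; `IsMultPAdicLFunctionOf f p a L`, the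
`Ω⁺_f`-normalisation): SOME coefficient of the Néron-normalised function `ϖ·L` (`∈ Λ` by Wuthrich 2014 Cor. 18) is a
`p`-adic unit — `μ(ϖ·L) = 0`. Class-wide this is Conj. 1.11 read through the main conjecture (OPEN); PER PAIR a
finite exact modular-symbol certificate. A `Prop` constant; OPEN; nothing asserted.
[cite: GreenbergLNM1716, §1 Conj. 1.11 (p. 61) (shape only; nothing asserted)]
[cite: Wuthrich2014, Cor. 18 (p. 398) (ϖ·L_p(E) ∈ Λ at a multiplicative odd prime)]
[cite: MazurTateTeitelbaum1986, §I.10 and §I.14 (allowable root a_p at p ∥ N)] -/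
@[conjecture]
def X11aNonSurjMuAn : Prop :=
  ∀ (W : WeierstrassCurve ℚ) [W.IsElliptic] [W.IsGloballyMinimal] (p : ℕ) [Fact p.Prime],
    ClassX11a W p → ¬ Surj W p →
    ∀ {N : ℕ} [NeZero N] (f : CuspForm (Gamma0 N) 2), IsNewformOf W f →
    ∀ (ϖ : ℚ), (ϖ : ℝ) * W.realPeriodRat = plusPeriod f →
    ∀ (a : ℚ_[p]) (L : PowerSeries ℚ_[p]),
      (W.HasSplitMultiplicativeReductionAtPrime p → a = 1) →
      (¬ W.HasSplitMultiplicativeReductionAtPrime p → a = -1) →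
      IsMultPAdicLFunctionOf f p a L →
      ∃ n : ℕ, ‖PowerSeries.coeff n (PowerSeries.C ((ϖ : ℚ) : ℚ_[p]) * L)‖ = 1

/-- [crux branch MuAn@3 of item 20406 `X11aNonSurjEulerHalf`] **analytic `μ = 0` at the non-surjective X11a pairs
with `p = 3`**: the restriction of `X11aNonSurjMuAn` to `p = 3` (at `p ∈ {5,7}` the sibling is item 19948
`Theses.ErratumRoadFive.NonSurjCornerTwinMuAn`). A `Prop` constant; OPEN; nothing asserted.
[cite: GreenbergLNM1716, §1 Conj. 1.11 (p. 61) (shape only; nothing asserted)] [cite: Wuthrich2014, Cor. 18 (p. 398)] -/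
@[conjecture]
def X11aNonSurjMuAnAtThree : Prop :=
  ∀ (W : WeierstrassCurve ℚ) [W.IsElliptic] [W.IsGloballyMinimal] (p : ℕ) [Fact p.Prime],
    ClassX11a W p → ¬ Surj W p → p = 3 →
    ∀ {N : ℕ} [NeZero N] (f : CuspForm (Gamma0 N) 2), IsNewformOf W f →
    ∀ (ϖ : ℚ), (ϖ : ℝ) * W.realPeriodRat = plusPeriod f →
    ∀ (a : ℚ_[p]) (L : PowerSeries ℚ_[p]),
      (W.HasSplitMultiplicativeReductionAtPrime p → a = 1) →
      (¬ W.HasSplitMultiplicativeReductionAtPrime p → a = -1) →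
      IsMultPAdicLFunctionOf f p a L →
      ∃ n : ℕ, ‖PowerSeries.coeff n (PowerSeries.C ((ϖ : ℚ) : ℚ_[p]) * L)‖ = 1

end Summit.BirchSwinnertonDyer.BirchSwinnertonDyer.Theorems

end
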